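import Summits.QuantumFields.YangMills.Theorems.SwapVirialDeficitQuantitativeLaplaceFibred
import Literature.Analysis.Asymptotics.LaplaceMethodChart
import HarnessLib

/-!
# The quantitative Morse–Bott Laplace method THROUGH A FIBRED CHART (tubular coordinates with Jacobian) on an
# abstract measure space, with the off-tube tail — the consumer form
# (free-hands support of ⟨stmt-QuantumFields-24197⟩ `SwapVirialDeficit.SwapGluedStiffness`; generic, sequel of
# ✓`SwapVirialDeficitQuantitativeLaplaceFibred`)

The quantitative twin of the Literature limit theorem `Literature.Analysis.Asymptotics.tendsto_laplaceMethod_fibred_chart`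
(Morse–Bott through a fibred chart), built on ✓`laplaceMethod_quantitative_fibred` (this seat, p827105) exactly as the limit theorem is
built on `tendsto_laplaceMethod_fibred`, with the chart glue ✓`setIntegral_image_eq_of_chart` ∕ ✓`integrableOn_image_iff_of_chart`.

THE STATEMENT (★★★ `laplaceMethod_quantitative_fibred_chart`).  `(X, μ)` a FINITE measure space (a compact group, `SU(2)^E`, …),
`(M, ν)` an s-finite measure space (the critical manifold with the measure it carries), `V` an `m`-dimensional real inner-product space with
Lebesgue measure, `Ψ : M × V → X` measurable (tubular coordinates), the TUBE `T = M × B̄_R` with `Ψ(T)` measurable and the FIBRED CHART IDENTITY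
`μ|_{Ψ(T)} = Ψ_*((J · ν ⊗ dy)|_T)` for a measurable Jacobian `J ≥ 0` on `T`; `f, φ : X → ℝ` measurable with, in the chart, the window data of
the Euclidean core with UNIFORM constants — `f(Ψ(p,y)) − f₀ = ½⟪A p y,y⟫ + c(p,y) + r(p,y)` and `J(p,y)·φ(Ψ(p,y)) = w₀(p)(1 + ℓ(p,y) + e(p,y))` on
`‖y‖ ≤ R`, `A p` symmetric uniformly `λ`-coercive and jointly measurable, `c, ℓ` odd in `y`, `|c| ≤ A₃‖y‖³`, `|r| ≤ A₄‖y‖⁴`, `|ℓ| ≤ D‖y‖`,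
`|e| ≤ G‖y‖²`, jointly measurable, `0 ≤ w₀ ∈ L¹(ν)`, `A₃R + A₄R² ≤ λ/(8(m+8))`, `DR ≤ 1`, `GR² ≤ 1` — and OFF the tube the separation
`f ≥ f₀ + η₀` and the bound `|φ| ≤ Φ₀` (`Φ₀ ≥ 0`).  THEN for every `β > 0`, with `𝔐(β) = (2π/β)^{m/2}·∫_M w₀ (det A p)^{−1/2} dν` and the polynomial
`K` of the core,

  `e^{−β(f − f₀)}φ ∈ L¹(μ)`  and  `|∫_X e^{−β(f − f₀)} φ dμ − 𝔐(β)| ≤ (K/β)·𝔐(β) + Φ₀·μ(X)·e^{−βη₀}`.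

★★ `log_laplaceMethod_quantitative_fibred_chart`: if `t := K/β + Φ₀ μ(X) e^{−βη₀}/𝔐(β) ≤ 1/2` and the base integral is positive, then
`∫_X e^{−β(f−f₀)}φ dμ > 0` and `|log ∫_X e^{−β(f−f₀)}φ dμ − (log ∫_M w₀ (det A p)^{−1/2}dν + (m/2)log 2π − (m/2)log β)| ≤ 2t`.
(On a Laplace window the tail term is `e^{−β^{1−O(a)}}`, far below `K/β`; its conversion is left to the consumer's window arithmetic,
cf. ✓`VirialFluxGap.OrbitAssembly.window_tail`.)

HONEST FRAMING: measure-theoretic glue (change of variables + an exponentially small tail) around a proved analytic core; width 0 by itself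
toward any lattice statement; the tubular coordinates `Ψ`, the Jacobian `J`, the fibre data of any ring deficit are NOT produced here;
⟨24197⟩, ⟨24196⟩, ⟨24194⟩, ⟨24497⟩ and every rung ∕ summit statement stay OPEN; own crux ⟨22884⟩ OPEN (blocked-on ⟨19935⟩); the Yang–Mills
mass gap is NOT proved; no summit is proved by a line.  Width seat ym-line-sfw-p2-w2 g58 (cell ym-idea-1, free hands),
`--supports stmt-QuantumFields-24197`.  THEOREMS ONLY (0 `def`, 0 `sorry`), standard axioms.

## References
* M. Hasenpflug, D. Rudolf, B. Sprungk, *Wasserstein convergence rates of increasingly concentrating probability measures*,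
  Ann. Appl. Probab. 34 (2024), §3.1 Assumption 3 (M)(T)(P), App. 4.1 Thm 16 ∕ Remark 17. [HasenpflugRudolfSprungk2024]
* K. W. Breitung, *Asymptotic Approximations for Probability Integrals*, LNM 1592 (1994), Thm 41 p. 56, §2.3 Definitions 4–5
  pp. 14–15 (local coordinates). [Breitung1994]
-/

set_option autoImplicit false

noncomputable section

open _root_.MeasureTheory _root_.Filter _root_.Set _root_.Module _root_.Metric
open scoped _root_.Topology _root_.Real _root_.InnerProductSpace

namespace Summit.QuantumFields.YangMills.Theorems.QuantitativeLaplace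

open Literature.Analysis.Asymptotics

variable {X : Type*} [MeasurableSpace X] {μ : Measure X} [IsFiniteMeasure μ]
variable {M : Type*} [MeasurableSpace M] {ν : Measure M} [SFinite ν]
variable {V : Type*} [NormedAddCommGroup V] [InnerProductSpace ℝ V] [FiniteDimensional ℝ V]
  [MeasurableSpace V] [BorelSpace V]

/-- ★★★ **Quantitative Morse–Bott Laplace method through a fibred chart, with the off-tube tail.**  See the module docstring:
under the fibred chart identity `μ|_{Ψ(M×B̄_R)} = Ψ_*((J·ν⊗dy)|_{M×B̄_R})`, the uniform fibre data of ✓`laplaceMethod_quantitative_fibred` for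
`f∘Ψ − f₀` and `J·φ∘Ψ`, and `f ≥ f₀ + η₀`, `|φ| ≤ Φ₀` off the tube, for every `β > 0`:
`e^{−β(f−f₀)}φ ∈ L¹(μ)` and `|∫_X e^{−β(f−f₀)}φ dμ − 𝔐(β)| ≤ (K/β)·𝔐(β) + Φ₀·μ(X)·e^{−βη₀}`, `𝔐(β) = (2π/β)^{m/2}∫_M w₀/√det(A p) dν`.
[cite: HasenpflugRudolfSprungk2024, §3.1 Assumption 3 (T) and App. 4.1 Thm 16] [cite: Breitung1994, Thm 41 p. 56 with §2.3 Definitions 4–5] -/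
theorem laplaceMethod_quantitative_fibred_chart {Ψ : M × V → X} {J : M × V → ℝ} {f φ : X → ℝ} {f₀ : ℝ}
    {A : M → V →ₗ[ℝ] V} (hA : ∀ p, (A p).IsSymmetric) {lam : ℝ} (hlam : 0 < lam)
    (hcoer : ∀ p (y : V), lam * ‖y‖ ^ 2 ≤ ⟪A p y, y⟫_ℝ)
    (hAm : Measurable fun z : M × V => ⟪A z.1 z.2, z.2⟫_ℝ)
    {R A₃ A₄ D G β η₀ Φ₀ : ℝ} (hR : 0 < R) (hA₃ : 0 ≤ A₃) (hA₄ : 0 ≤ A₄) (hD : 0 ≤ D) (hG : 0 ≤ G) (hβ : 0 < β)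
    (hsmall : A₃ * R + A₄ * R ^ 2 ≤ lam / (8 * ((finrank ℝ V : ℝ) + 8)))
    (hDR : D * R ≤ 1) (hGR : G * R ^ 2 ≤ 1)
    (hΨ : Measurable Ψ) (hΨT : MeasurableSet (Ψ '' (univ ×ˢ closedBall (0 : V) R)))
    (hJm : Measurable J) (hJ0 : ∀ z ∈ (univ : Set M) ×ˢ closedBall (0 : V) R, 0 ≤ J z)
    (hchart : μ.restrict (Ψ '' (univ ×ˢ closedBall (0 : V) R)) =
      (((ν.prod volume).restrict (univ ×ˢ closedBall (0 : V) R)).withDensity fun z => ENNReal.ofReal (J z)).map Ψ)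
    (hfm : Measurable f) (hφm : Measurable φ)
    {c r ℓ e : M × V → ℝ} {w₀ : M → ℝ}
    (hc_meas : Measurable c) (hr_meas : Measurable r) (hℓ_meas : Measurable ℓ) (he_meas : Measurable e)
    (hw₀m : Measurable w₀) (hw₀ : ∀ p, 0 ≤ w₀ p) (hw₀i : Integrable w₀ ν)
    (hc_odd : ∀ p (y : V), c (p, -y) = -c (p, y)) (hℓ_odd : ∀ p (y : V), ℓ (p, -y) = -ℓ (p, y))
    (hc : ∀ p (y : V), ‖y‖ ≤ R → |c (p, y)| ≤ A₃ * ‖y‖ ^ 3) (hr : ∀ p (y : V), ‖y‖ ≤ R → |r (p, y)| ≤ A₄ * ‖y‖ ^ 4)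
    (hℓ : ∀ p (y : V), ‖y‖ ≤ R → |ℓ (p, y)| ≤ D * ‖y‖) (he : ∀ p (y : V), ‖y‖ ≤ R → |e (p, y)| ≤ G * ‖y‖ ^ 2)
    (hf : ∀ p (y : V), ‖y‖ ≤ R → f (Ψ (p, y)) - f₀ = (1 / 2) * ⟪A p y, y⟫_ℝ + c (p, y) + r (p, y))
    (hw : ∀ p (y : V), ‖y‖ ≤ R → J (p, y) * φ (Ψ (p, y)) = w₀ p * (1 + ℓ (p, y) + e (p, y)))
    (hout : ∀ x, x ∉ Ψ '' (univ ×ˢ closedBall (0 : V) R) → f₀ + η₀ ≤ f x)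
    (hΦ₀nn : 0 ≤ Φ₀) (hΦ₀ : ∀ x, x ∉ Ψ '' (univ ×ˢ closedBall (0 : V) R) → |φ x| ≤ Φ₀) :
    Integrable (fun x => Real.exp (-(β * (f x - f₀))) * φ x) μ ∧
    |(∫ x, Real.exp (-(β * (f x - f₀))) * φ x ∂μ) -
        (2 * π / β) ^ ((finrank ℝ V : ℝ) / 2) * ∫ p, w₀ p / Real.sqrt (LinearMap.det (A p)) ∂ν| ≤
      (16 * ((finrank ℝ V : ℝ) + 8) / (lam * R ^ 2) + 16 * G * ((finrank ℝ V : ℝ) + 8) / lam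
        + 256 * (A₄ + (A₃ + A₄ * R) * (D + G * R)) * ((finrank ℝ V : ℝ) + 8) ^ 2 / lam ^ 2
        + 18432 * (A₃ + A₄ * R) ^ 2 * ((finrank ℝ V : ℝ) + 8) ^ 3 / lam ^ 3) / β *
        ((2 * π / β) ^ ((finrank ℝ V : ℝ) / 2) * ∫ p, w₀ p / Real.sqrt (LinearMap.det (A p)) ∂ν) +
      Φ₀ * μ.real univ * Real.exp (-(β * η₀)) := by
  set T : Set (M × V) := (univ : Set M) ×ˢ closedBall (0 : V) R with hTdef
  have hTm : MeasurableSet T := MeasurableSet.univ.prod measurableSet_closedBall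
  set F : X → ℝ := fun x => Real.exp (-(β * (f x - f₀))) * φ x with hFdef
  have hFm : Measurable F := (((hfm.sub measurable_const).const_mul β).neg.exp).mul hφm
  -- the pulled-back phase and amplitude on `M × V`
  set ft : M × V → ℝ := fun z => f (Ψ z) - f₀ with hft
  set wt : M × V → ℝ := fun z => J z * φ (Ψ z) with hwt
  have hftm : Measurable ft := (hfm.comp hΨ).sub measurable_const
  have hwtm : Measurable wt := hJm.mul (hφm.comp hΨ)
  -- ★ the fibred Euclidean theorem for `(ft, wt)` on the tube `T`
  obtain ⟨hTint, -, hbd⟩ := laplaceMethod_quantitative_fibred (f := ft) (w := wt) hA hlam hcoer hAm hR hA₃ hA₄ hD hG hβ hsmall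
    hDR hGR hftm hwtm hc_meas hr_meas hℓ_meas he_meas hw₀m hw₀ hw₀i hc_odd hℓ_odd hc hr hℓ he
    (fun p y hy => by simp only [hft]; exact hf p y hy) (fun p y hy => by simp only [hwt]; exact hw p y hy)
  -- the chart: tube integral and integrability
  have hJF : ∀ z : M × V, J z * F (Ψ z) = Real.exp (-(β * ft z)) * wt z := fun z => by
    simp only [hFdef, hft, hwt]; ring
  have hTint' : IntegrableOn (fun z => J z * F (Ψ z)) T (ν.prod volume) :=
    hTint.congr_fun (fun z _ => (hJF z).symm) hTm
  have hinT : IntegrableOn F (Ψ '' T) μ := (integrableOn_image_iff_of_chart hΨ hTm hJm hJ0 hchart hFm).2 hTint'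
  have htube : ∫ x in Ψ '' T, F x ∂μ = ∫ z in T, Real.exp (-(β * ft z)) * wt z ∂(ν.prod volume) := by
    rw [setIntegral_image_eq_of_chart hΨ hTm hJm hJ0 hchart hFm]
    exact setIntegral_congr_fun hTm fun z _ => hJF z
  -- the complement: `|F| ≤ Φ₀ e^{−βη₀}` there
  have hFout : ∀ x ∈ (Ψ '' T)ᶜ, ‖F x‖ ≤ Φ₀ * Real.exp (-(β * η₀)) := by
    intro x hx
    rw [Set.mem_compl_iff] at hx
    rw [Real.norm_eq_abs, hFdef]
    simp only [abs_mul, abs_of_pos (Real.exp_pos _)]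
    rw [mul_comm]
    refine mul_le_mul (hΦ₀ x hx) ?_ (Real.exp_pos _).le hΦ₀nn
    rw [Real.exp_le_exp]
    have := hout x hx
    nlinarith
  have hμc : μ ((Ψ '' T)ᶜ) < ⊤ := measure_lt_top μ _
  have houtT : IntegrableOn F (Ψ '' T)ᶜ μ :=
    Measure.integrableOn_of_bounded hμc.ne hFm.aestronglyMeasurable
      ((ae_restrict_iff' hΨT.compl).mpr (Eventually.of_forall fun x hx => hFout x hx))
  have hFint : Integrable F μ := by
    have h := hinT.union houtT
    rwa [Set.union_compl_self, integrableOn_univ] at h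
  have htail : |∫ x in (Ψ '' T)ᶜ, F x ∂μ| ≤ Φ₀ * μ.real univ * Real.exp (-(β * η₀)) := by
    have h1 := norm_setIntegral_le_of_norm_le_const hμc hFout
    rw [Real.norm_eq_abs] at h1
    refine h1.trans ?_
    have h2 : μ.real ((Ψ '' T)ᶜ) ≤ μ.real univ := measureReal_mono (Set.subset_univ _) (measure_ne_top μ _)
    have h3 : 0 ≤ Φ₀ * Real.exp (-(β * η₀)) := mul_nonneg hΦ₀nn (Real.exp_pos _).le
    calc Φ₀ * Real.exp (-(β * η₀)) * μ.real ((Ψ '' T)ᶜ) ≤ Φ₀ * Real.exp (-(β * η₀)) * μ.real univ :=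
        mul_le_mul_of_nonneg_left h2 h3
      _ = Φ₀ * μ.real univ * Real.exp (-(β * η₀)) := by ring
  -- assemble
  refine ⟨hFint, ?_⟩
  have hsplit : ∫ x, F x ∂μ = (∫ x in Ψ '' T, F x ∂μ) + ∫ x in (Ψ '' T)ᶜ, F x ∂μ := (integral_add_compl hΨT hFint).symm
  rw [hsplit, htube]
  calc |(∫ z in T, Real.exp (-(β * ft z)) * wt z ∂(ν.prod volume)) + (∫ x in (Ψ '' T)ᶜ, F x ∂μ) -
        (2 * π / β) ^ ((finrank ℝ V : ℝ) / 2) * ∫ p, w₀ p / Real.sqrt (LinearMap.det (A p)) ∂ν|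
      = |((∫ z in T, Real.exp (-(β * ft z)) * wt z ∂(ν.prod volume)) -
          (2 * π / β) ^ ((finrank ℝ V : ℝ) / 2) * ∫ p, w₀ p / Real.sqrt (LinearMap.det (A p)) ∂ν) +
          ∫ x in (Ψ '' T)ᶜ, F x ∂μ| := by ring_nf
    _ ≤ |(∫ z in T, Real.exp (-(β * ft z)) * wt z ∂(ν.prod volume)) -
          (2 * π / β) ^ ((finrank ℝ V : ℝ) / 2) * ∫ p, w₀ p / Real.sqrt (LinearMap.det (A p)) ∂ν| +
          |∫ x in (Ψ '' T)ᶜ, F x ∂μ| := abs_add_le _ _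
    _ ≤ _ := add_le_add hbd htail

/-- ★★ **Logarithmic form.**  Under the hypotheses of `laplaceMethod_quantitative_fibred_chart`, if the base integral
`J = ∫_M w₀ (det A p)^{−1/2} dν` is positive and the total relative error `t := K/β + Φ₀·μ(X)·e^{−βη₀}/𝔐(β)` is `≤ 1/2`
(`𝔐(β) = (2π/β)^{m/2}·J`), then `∫_X e^{−β(f−f₀)}φ dμ > 0` and
`|log ∫_X e^{−β(f−f₀)}φ dμ − (log J + (m/2)·log(2π) − (m/2)·log β)| ≤ 2t`.
[cite: HasenpflugRudolfSprungk2024, App. 4.1 Thm 16] [cite: Breitung1994, Thm 41 p. 56] -/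
theorem log_laplaceMethod_quantitative_fibred_chart {Ψ : M × V → X} {J : M × V → ℝ} {f φ : X → ℝ} {f₀ : ℝ}
    {A : M → V →ₗ[ℝ] V} (hA : ∀ p, (A p).IsSymmetric) {lam : ℝ} (hlam : 0 < lam)
    (hcoer : ∀ p (y : V), lam * ‖y‖ ^ 2 ≤ ⟪A p y, y⟫_ℝ)
    (hAm : Measurable fun z : M × V => ⟪A z.1 z.2, z.2⟫_ℝ)
    {R A₃ A₄ D G β η₀ Φ₀ : ℝ} (hR : 0 < R) (hA₃ : 0 ≤ A₃) (hA₄ : 0 ≤ A₄) (hD : 0 ≤ D) (hG : 0 ≤ G) (hβ : 0 < β)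
    (hsmall : A₃ * R + A₄ * R ^ 2 ≤ lam / (8 * ((finrank ℝ V : ℝ) + 8)))
    (hDR : D * R ≤ 1) (hGR : G * R ^ 2 ≤ 1)
    (hΨ : Measurable Ψ) (hΨT : MeasurableSet (Ψ '' (univ ×ˢ closedBall (0 : V) R)))
    (hJm : Measurable J) (hJ0 : ∀ z ∈ (univ : Set M) ×ˢ closedBall (0 : V) R, 0 ≤ J z)
    (hchart : μ.restrict (Ψ '' (univ ×ˢ closedBall (0 : V) R)) =
      (((ν.prod volume).restrict (univ ×ˢ closedBall (0 : V) R)).withDensity fun z => ENNReal.ofReal (J z)).map Ψ)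
    (hfm : Measurable f) (hφm : Measurable φ)
    {c r ℓ e : M × V → ℝ} {w₀ : M → ℝ}
    (hc_meas : Measurable c) (hr_meas : Measurable r) (hℓ_meas : Measurable ℓ) (he_meas : Measurable e)
    (hw₀m : Measurable w₀) (hw₀ : ∀ p, 0 ≤ w₀ p) (hw₀i : Integrable w₀ ν)
    (hc_odd : ∀ p (y : V), c (p, -y) = -c (p, y)) (hℓ_odd : ∀ p (y : V), ℓ (p, -y) = -ℓ (p, y))
    (hc : ∀ p (y : V), ‖y‖ ≤ R → |c (p, y)| ≤ A₃ * ‖y‖ ^ 3) (hr : ∀ p (y : V), ‖y‖ ≤ R → |r (p, y)| ≤ A₄ * ‖y‖ ^ 4)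
    (hℓ : ∀ p (y : V), ‖y‖ ≤ R → |ℓ (p, y)| ≤ D * ‖y‖) (he : ∀ p (y : V), ‖y‖ ≤ R → |e (p, y)| ≤ G * ‖y‖ ^ 2)
    (hf : ∀ p (y : V), ‖y‖ ≤ R → f (Ψ (p, y)) - f₀ = (1 / 2) * ⟪A p y, y⟫_ℝ + c (p, y) + r (p, y))
    (hw : ∀ p (y : V), ‖y‖ ≤ R → J (p, y) * φ (Ψ (p, y)) = w₀ p * (1 + ℓ (p, y) + e (p, y)))
    (hout : ∀ x, x ∉ Ψ '' (univ ×ˢ closedBall (0 : V) R) → f₀ + η₀ ≤ f x)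
    (hΦ₀nn : 0 ≤ Φ₀) (hΦ₀ : ∀ x, x ∉ Ψ '' (univ ×ˢ closedBall (0 : V) R) → |φ x| ≤ Φ₀)
    (hJpos : 0 < ∫ p, w₀ p / Real.sqrt (LinearMap.det (A p)) ∂ν)
    (ht : (16 * ((finrank ℝ V : ℝ) + 8) / (lam * R ^ 2) + 16 * G * ((finrank ℝ V : ℝ) + 8) / lam
        + 256 * (A₄ + (A₃ + A₄ * R) * (D + G * R)) * ((finrank ℝ V : ℝ) + 8) ^ 2 / lam ^ 2
        + 18432 * (A₃ + A₄ * R) ^ 2 * ((finrank ℝ V : ℝ) + 8) ^ 3 / lam ^ 3) / β +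
        Φ₀ * μ.real univ * Real.exp (-(β * η₀)) /
          ((2 * π / β) ^ ((finrank ℝ V : ℝ) / 2) * ∫ p, w₀ p / Real.sqrt (LinearMap.det (A p)) ∂ν) ≤ 1 / 2) :
    0 < ∫ x, Real.exp (-(β * (f x - f₀))) * φ x ∂μ ∧
    |Real.log (∫ x, Real.exp (-(β * (f x - f₀))) * φ x ∂μ) -
        (Real.log (∫ p, w₀ p / Real.sqrt (LinearMap.det (A p)) ∂ν) + ((finrank ℝ V : ℝ) / 2) * Real.log (2 * π) -
          ((finrank ℝ V : ℝ) / 2) * Real.log β)| ≤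
      2 * ((16 * ((finrank ℝ V : ℝ) + 8) / (lam * R ^ 2) + 16 * G * ((finrank ℝ V : ℝ) + 8) / lam
        + 256 * (A₄ + (A₃ + A₄ * R) * (D + G * R)) * ((finrank ℝ V : ℝ) + 8) ^ 2 / lam ^ 2
        + 18432 * (A₃ + A₄ * R) ^ 2 * ((finrank ℝ V : ℝ) + 8) ^ 3 / lam ^ 3) / β +
        Φ₀ * μ.real univ * Real.exp (-(β * η₀)) /
          ((2 * π / β) ^ ((finrank ℝ V : ℝ) / 2) * ∫ p, w₀ p / Real.sqrt (LinearMap.det (A p)) ∂ν)) := by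
  obtain ⟨-, hbd⟩ := laplaceMethod_quantitative_fibred_chart hA hlam hcoer hAm hR hA₃ hA₄ hD hG hβ hsmall hDR hGR hΨ hΨT hJm hJ0 hchart
    hfm hφm hc_meas hr_meas hℓ_meas he_meas hw₀m hw₀ hw₀i hc_odd hℓ_odd hc hr hℓ he hf hw hout hΦ₀nn hΦ₀
  set Kc : ℝ := (16 * ((finrank ℝ V : ℝ) + 8) / (lam * R ^ 2) + 16 * G * ((finrank ℝ V : ℝ) + 8) / lam
        + 256 * (A₄ + (A₃ + A₄ * R) * (D + G * R)) * ((finrank ℝ V : ℝ) + 8) ^ 2 / lam ^ 2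
        + 18432 * (A₃ + A₄ * R) ^ 2 * ((finrank ℝ V : ℝ) + 8) ^ 3 / lam ^ 3) with hKc
  set Jb : ℝ := ∫ p, w₀ p / Real.sqrt (LinearMap.det (A p)) ∂ν with hJb
  have hcpow_pos : 0 < (2 * π / β) ^ ((finrank ℝ V : ℝ) / 2) := Real.rpow_pos_of_pos (by positivity) _
  set Mn : ℝ := (2 * π / β) ^ ((finrank ℝ V : ℝ) / 2) * Jb with hMn
  have hMn_pos : 0 < Mn := mul_pos hcpow_pos hJpos
  set t : ℝ := Kc / β + Φ₀ * μ.real univ * Real.exp (-(β * η₀)) / Mn with htdef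
  have hbd' : |(∫ x, Real.exp (-(β * (f x - f₀))) * φ x ∂μ) - Mn| ≤ t * Mn := by
    have heq : t * Mn = Kc / β * Mn + Φ₀ * μ.real univ * Real.exp (-(β * η₀)) := by
      rw [htdef]
      field_simp
    rw [heq]
    exact hbd
  obtain ⟨hIpos, hlog⟩ := abs_log_sub_log_le_of_abs_sub_le hMn_pos ht hbd'
  refine ⟨hIpos, ?_⟩
  have hmain : Real.log Mn = Real.log Jb + ((finrank ℝ V : ℝ) / 2) * Real.log (2 * π) - ((finrank ℝ V : ℝ) / 2) * Real.log β := by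
    rw [hMn, mul_comm]
    exact log_mul_rpow_div Jb _ β hJpos hβ
  rw [← hmain]
  exact hlog

end Summit.QuantumFields.YangMills.Theorems.QuantitativeLaplace

end
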